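import Summits.RiemannHypothesis.RiemannHypothesis.Theorems.WeilFormatCCinfGramHankel
import Literature.NumberTheory.LFunctions.WeilMarkovQuadratic
import HarnessLib

/-!
# Format C, design C∞: square-summability of the four family TAGS (the `hT` input of the Hankel family-Gram lemma)

Route context: Fourier–Galerkin / Schur-complement certificates of Weil positivity on a window ("format C", C∞ door;
cell memo `run/shared/lean/pub/rh-explicit/rh-explicit-weil-10/KERNEL-LEVER.md` §22–§23; supporting stmt-RiemannHypothesis-0098;
seat rh-explicit-weil-10).  weil-2's `cinf_sum_Ico_sq_le_of_hankel_boxes` (`WeilFormatCCinfGramHankel`) and the odd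
`cinf_sum_Ico_sq_le_of_hankel_boxes_succ` turn Hankel entry boxes into the doors' family-Gram hypothesis `hΓ`, given the
square-summability `Σ_k T_t(M+k)²/(M+k)² < ∞` of each tag `T_t ∈ {1, log m, −C_m, S_m}`
(`C_m/S_m = Σ_{n ∈ weilPrimeIndex a} Λ(n) n^{-1/2} cos/sin(πm/a·log n)`).  This file discharges that input ONCE for the
printed tag vector of the C∞ packages (`cinf_facts_*`), so that a rung passes `cinf_tags_summable a hM` and no
summability hypothesis remains on the data side:

* `abs_primeCos_le`, `abs_primeSin_le` — `|C_m|, |S_m| ≤ Σ_{n} Λ(n)/√n`;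
* `cinf_tags_summable` — for `4 ≤ M` and every tag `t : Fin 4`,
  `Summable fun k ↦ (TAG t (M+k))² / (M+k)²` with `TAG` the printed lambda (even threshold `M = m₀e`, odd `M = m₀o+1`).

Elementary (bounded tags + weil-2's `cinf_summable_tag_sq_of_abs_le` / `cinf_summable_log_sq`); standard axioms; no RH claim.
-/

set_option autoImplicit false
-- `Summit.RiemannHypothesis.RiemannHypothesis.…` is the layout-mandated namespace (summit = problem name).
set_option linter.dupNamespace false

noncomputable section

open Finset
open scoped Real ArithmeticFunction.vonMangoldt

namespace Summit.RiemannHypothesis.RiemannHypothesis.Theorems.WeilFormatC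

open Literature.NumberTheory.LFunctions

/-- `|C_m| ≤ Σ_n Λ(n)/√n` for the prime cosine sum at any phase factor `x`. -/
theorem abs_primeCos_le (a x : ℝ) :
    |∑ n ∈ weilPrimeIndex a, (Λ n : ℝ) / Real.sqrt n * Real.cos (x * Real.log n)|
      ≤ ∑ n ∈ weilPrimeIndex a, (Λ n : ℝ) / Real.sqrt n := by
  refine (Finset.abs_sum_le_sum_abs _ _).trans (Finset.sum_le_sum fun n _ ↦ ?_)
  rw [abs_mul, abs_of_nonneg (div_nonneg ArithmeticFunction.vonMangoldt_nonneg (Real.sqrt_nonneg _))]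
  exact mul_le_of_le_one_right (div_nonneg ArithmeticFunction.vonMangoldt_nonneg (Real.sqrt_nonneg _))
    (Real.abs_cos_le_one _)

/-- `|S_m| ≤ Σ_n Λ(n)/√n` for the prime sine sum at any phase factor `x`. -/
theorem abs_primeSin_le (a x : ℝ) :
    |∑ n ∈ weilPrimeIndex a, (Λ n : ℝ) / Real.sqrt n * Real.sin (x * Real.log n)|
      ≤ ∑ n ∈ weilPrimeIndex a, (Λ n : ℝ) / Real.sqrt n := by
  refine (Finset.abs_sum_le_sum_abs _ _).trans (Finset.sum_le_sum fun n _ ↦ ?_)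
  rw [abs_mul, abs_of_nonneg (div_nonneg ArithmeticFunction.vonMangoldt_nonneg (Real.sqrt_nonneg _))]
  exact mul_le_of_le_one_right (div_nonneg ArithmeticFunction.vonMangoldt_nonneg (Real.sqrt_nonneg _))
    (Real.abs_sin_le_one _)

/-- **Square-summability of the four tags** `T_t(m) ∈ {1, log m, −C_m, S_m}` beyond any threshold `M ≥ 4`:
`Σ_k T_t(M+k)²/(M+k)² < ∞` — the `hT` input of `cinf_sum_Ico_sq_le_of_hankel_boxes` (`M = m₀e`) and of
`cinf_sum_Ico_sq_le_of_hankel_boxes_succ` (`M = m₀o + 1`), for the tag lambda printed in the C∞ packages. -/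
theorem cinf_tags_summable (a : ℝ) {M : ℕ} (hM : 4 ≤ M) (t : Fin 4) :
    Summable fun k : ℕ ↦ (fun (t : Fin 4) (m : ℕ) ↦ ![(1 : ℝ), Real.log m,
        -(∑ n ∈ weilPrimeIndex a, (Λ n : ℝ) / Real.sqrt n * Real.cos (π * m / a * Real.log n)),
        (∑ n ∈ weilPrimeIndex a, (Λ n : ℝ) / Real.sqrt n * Real.sin (π * m / a * Real.log n))] t) t (M + k) ^ 2
      / ((M + k : ℕ) : ℝ) ^ 2 := by
  fin_cases t
  · simpa using cinf_summable_tag_sq_of_abs_le (T := fun _ : ℕ ↦ (1 : ℝ)) (A := 1) (fun _ ↦ by simp) M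
  · simpa using cinf_summable_log_sq hM
  · have h := cinf_summable_tag_sq_of_abs_le
      (T := fun m : ℕ ↦ -(∑ n ∈ weilPrimeIndex a, (Λ n : ℝ) / Real.sqrt n * Real.cos (π * m / a * Real.log n)))
      (A := ∑ n ∈ weilPrimeIndex a, (Λ n : ℝ) / Real.sqrt n) (fun m ↦ by rw [abs_neg]; exact abs_primeCos_le a _) M
    simpa using h
  · have h := cinf_summable_tag_sq_of_abs_le
      (T := fun m : ℕ ↦ ∑ n ∈ weilPrimeIndex a, (Λ n : ℝ) / Real.sqrt n * Real.sin (π * m / a * Real.log n))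
      (A := ∑ n ∈ weilPrimeIndex a, (Λ n : ℝ) / Real.sqrt n) (fun m ↦ abs_primeSin_le a _) M
    simpa using h

end Summit.RiemannHypothesis.RiemannHypothesis.Theorems.WeilFormatC

end
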